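import Literature.Computability.MetaComplexity.FregeMod
import Literature.Computability.MetaComplexity.KEvaluations
import Mathlib.Data.Nat.Pairing
import Mathlib.Data.ZMod.Basic
import HarnessLib

/-!
# `MOD₂` summation, concrete level, I: the substitution of `MOD₂` formulas for the atoms

Support file for item `stmt-PneNP-11444` (`LinearGeneratorModPFregeHard`), calibration line "for
`p = 2` the rung fails".  The abstract files (`…Mod2Xor/RowWalk/Row/Chain/Fold.lean`) work with
atoms `var (zv c k κ)` standing for `MOD_{2,c}(y₀,…,y_{k-1})` of kind `κ` (`y_j = x_j` if
`j ∈ Dof κ`, else `⊥`) and with the skeleta of the `MOD₂` axioms as hypotheses.  Here: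

* `exists_modSubst` — a substitution `σ` with `σ x_v = x_v` (`v < n`) and
  `σ (zv c k κ) = MOD_{2,c}(y₀,…,y_{k-1})` (`k ≤ n`) exists for the coding
  `zv c k κ = n + ⟨⟨c,k⟩,κ⟩` (Cantor pairing), all of whose values have size `≤ n+1` and depth
  `≤ 1`;
* `isModAxiom_subst_ax1/ax2/ax3` — under any such `σ` the three skeleta become instances of the
  `MOD₂` axioms 1–3 of Buss et al. (`PropFormMod.IsModAxiom`);
* `subst_ofPropForm_eq_of_vars`, `exists_lit_of_mem_vars_ofCNF` — `σ` fixes every formula whose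
  variables are `< n`, in particular the target `¬ ofCNF φ`.

No definitions are introduced (the concrete `σ` lives inside the proof of `exists_modSubst`).

Sources: S. Buss, R. Impagliazzo, J. Krajíček, P. Pudlák, A. A. Razborov, J. Sgall, *Proof
complexity in algebraic systems and bounded depth Frege systems with modular counting*, Comput.
Complexity 6 (1996/97), Def. 1.1 (the `MOD_a` axioms, as formalised in `FregeMod.lean`).
-/

set_option linter.dupNamespace false -- `Summit.PneNP.PneNP.…`: summit = sub-problem (D-0017)

namespace Summit.PneNP.PneNP.Theorems.ModTwo

open Literature.Computability.Complexity Literature.Computability.Complexity.PropForm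
open Literature.Computability.MetaComplexity
open Literature.Computability.MetaComplexity.KEval (litForm clauseForm clauseForm_cons ofCNF_cons)

/-! ### Formulas fixed by a substitution -/

/-- A substitution that is the identity on the variables of `ψ` fixes `ofPropForm ψ`.
[Cook–Reckhow 1979, §2] [folklore] -/
theorem subst_ofPropForm_eq_of_vars {a : ℕ} (σ : ℕ → PropFormMod a ℕ) :
    ∀ ψ : PropForm ℕ, (∀ v ∈ ψ.vars, σ v = .var v) →
      (PropFormMod.ofPropForm ψ).subst σ = PropFormMod.ofPropForm ψ
  | .var v, h => by simpa [PropFormMod.ofPropForm, PropFormMod.subst, PropForm.vars] using h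
  | .const b, _ => rfl
  | .neg φ, h => by
    simp only [PropFormMod.ofPropForm, PropFormMod.subst]
    rw [subst_ofPropForm_eq_of_vars σ φ (fun v hv => h v (by simpa [PropForm.vars] using hv))]
  | .conj φ ψ, h => by
    simp only [PropFormMod.ofPropForm, PropFormMod.subst]
    rw [subst_ofPropForm_eq_of_vars σ φ (fun v hv => h v (by simp [PropForm.vars, hv])),
      subst_ofPropForm_eq_of_vars σ ψ (fun v hv => h v (by simp [PropForm.vars, hv]))]
  | .disj φ ψ, h => by
    simp only [PropFormMod.ofPropForm, PropFormMod.subst]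
    rw [subst_ofPropForm_eq_of_vars σ φ (fun v hv => h v (by simp [PropForm.vars, hv])),
      subst_ofPropForm_eq_of_vars σ ψ (fun v hv => h v (by simp [PropForm.vars, hv]))]

/-- The variables of `ofCNF φ` are the variables of the literals of `φ`. [folklore] -/
theorem exists_lit_of_mem_vars_ofCNF :
    ∀ (φ : CNF ℕ) {v : ℕ}, v ∈ (PropForm.ofCNF φ).vars → ∃ C ∈ φ, ∃ l ∈ C, l.1 = v
  | [], v, hv => by simp [PropForm.ofCNF, PropForm.vars] at hv
  | C :: φ, v, hv => by
    rw [ofCNF_cons] at hv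
    simp only [PropForm.vars, Finset.mem_union] at hv
    rcases hv with hv | hv
    · -- in the clause
      have key : ∀ (c : Clause ℕ), v ∈ (clauseForm c).vars → ∃ l ∈ c, l.1 = v := by
        intro c
        induction c with
        | nil => intro h; simp [clauseForm, PropForm.vars] at h
        | cons l c ih =>
          intro h
          rw [clauseForm_cons] at h
          simp only [PropForm.vars, Finset.mem_union] at h
          rcases h with h | h
          · refine ⟨l, List.mem_cons_self, ?_⟩
            unfold litForm at h
            split_ifs at h <;>
              · simp only [PropForm.vars, Finset.mem_singleton] at h; exact h.symm
          · obtain ⟨l', hl', e⟩ := ih h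
            exact ⟨l', List.mem_cons_of_mem _ hl', e⟩
      obtain ⟨l, hl, e⟩ := key C hv
      exact ⟨C, List.mem_cons_self, l, hl, e⟩
    · obtain ⟨C', hC', l, hl, e⟩ := exists_lit_of_mem_vars_ofCNF φ hv
      exact ⟨C', List.mem_cons_of_mem _ hC', l, hl, e⟩

/-! ### The substitution -/

/-- **The `MOD₂` substitution exists.** For the atom coding `zv c k κ = n + ⟨⟨c.val, k⟩, κ⟩`
there is `σ : ℕ → PropFormMod 2 ℕ` with `σ v = x_v` for `v < n`,
`σ (zv c k κ) = MOD_{2,c}(y₀, …, y_{k-1})` for `k ≤ n` (`y_j = x_j` if `j ∈ Dof κ`, else `⊥`),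
every value of size `≤ n + 1` and of auxiliary depth `≤ 1`. [Buss et al. 1997, Def. 1.1]
[folklore] -/
theorem exists_modSubst (n : ℕ) (Dof : ℕ → Finset ℕ) :
    ∃ σ : ℕ → PropFormMod 2 ℕ,
      (∀ v, v < n → σ v = .var v) ∧
      (∀ (c : ZMod 2) (k κ : ℕ), k ≤ n →
        σ (n + Nat.pair (Nat.pair c.val k) κ) =
          .modc c (fun j : Fin k => if (j : ℕ) ∈ Dof κ then .var (j : ℕ) else .const false)) ∧
      (∀ v, (σ v).size ≤ n + 1) ∧
      (∀ v c, PropFormMod.altDepthAux c (σ v) ≤ 1) := by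
  classical
  let σ : ℕ → PropFormMod 2 ℕ := fun v =>
    if v < n then .var v else
      .modc (((Nat.unpair (Nat.unpair (v - n)).1).1 : ℕ) : ZMod 2)
        (fun j : Fin (min (Nat.unpair (Nat.unpair (v - n)).1).2 n) =>
          if (j : ℕ) ∈ Dof (Nat.unpair (v - n)).2 then .var (j : ℕ) else .const false)
  have hargs_size : ∀ (k κ : ℕ),
      (∑ j : Fin k, (if (j : ℕ) ∈ Dof κ then PropFormMod.var (a := 2) (j : ℕ)
        else PropFormMod.const false).size) = k := by
    intro k κ
    calc _ = ∑ _j : Fin k, 1 := Finset.sum_congr rfl fun j _ => by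
            split_ifs <;> rfl
      _ = k := by simp
  have hargs_depth : ∀ (k κ : ℕ),
      (Finset.univ.sup fun j : Fin k => PropFormMod.altDepthAux 0
        (if (j : ℕ) ∈ Dof κ then PropFormMod.var (a := 2) (j : ℕ) else PropFormMod.const false))
        = 0 := by
    intro k κ
    refine le_antisymm (Finset.sup_le fun j _ => ?_) (Nat.zero_le _)
    split_ifs <;> simp [PropFormMod.altDepthAux]
  refine ⟨σ, fun v hv => by simp [σ, hv], fun c k κ hk => ?_, fun v => ?_, fun v c => ?_⟩
  · have hnlt : ¬ (n + Nat.pair (Nat.pair c.val k) κ < n) := by omega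
    show (if n + Nat.pair (Nat.pair c.val k) κ < n then _ else _) = _
    rw [if_neg hnlt, Nat.add_sub_cancel_left, Nat.unpair_pair, Nat.unpair_pair]
    dsimp only
    rw [min_eq_left hk, ZMod.natCast_zmod_val]
  · by_cases hv : v < n
    · simp [σ, hv, PropFormMod.size]
    · simp only [σ, hv, if_false, PropFormMod.size, hargs_size]
      exact Nat.succ_le_succ (min_le_right _ _)
  · by_cases hv : v < n
    · simp [σ, hv, PropFormMod.altDepthAux]
    · simp only [σ, hv, if_false, PropFormMod.altDepthAux, hargs_depth]
      omega

/-! ### The skeleta become `MOD₂` axioms -/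

section Axioms

variable {n : ℕ} {Dof : ℕ → Finset ℕ} {zv : ZMod 2 → ℕ → ℕ → ℕ} {σ : ℕ → PropFormMod 2 ℕ}

/-- Axiom 1: the skeleton `Z(0,0,κ)` becomes `MOD_{2,0}(∅)`. [Buss et al. 1997, Def. 1.1]
[folklore] -/
theorem isModAxiom_subst_ax1
    (hσz : ∀ (c : ZMod 2) (k κ : ℕ), k ≤ n → σ (zv c k κ) =
      .modc c (fun j : Fin k => if (j : ℕ) ∈ Dof κ then .var (j : ℕ) else .const false))
    (κ : ℕ) :
    PropFormMod.IsModAxiom ((PropFormMod.ofPropForm (PropForm.var (zv 0 0 κ))).subst σ) := by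
  refine Or.inl ?_
  simp only [PropFormMod.ofPropForm, PropFormMod.subst, hσz 0 0 κ (Nat.zero_le _)]
  congr 1
  funext j
  exact j.elim0

/-- Axiom 2: the skeleton `¬Z(1,0,κ)` becomes `¬MOD_{2,1}(∅)`. [Buss et al. 1997, Def. 1.1]
[folklore] -/
theorem isModAxiom_subst_ax2
    (hσz : ∀ (c : ZMod 2) (k κ : ℕ), k ≤ n → σ (zv c k κ) =
      .modc c (fun j : Fin k => if (j : ℕ) ∈ Dof κ then .var (j : ℕ) else .const false))
    (κ : ℕ) :
    PropFormMod.IsModAxiom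
      ((PropFormMod.ofPropForm (PropForm.neg (PropForm.var (zv 1 0 κ)))).subst σ) := by
  refine Or.inr (Or.inl ⟨1, by decide, ?_⟩)
  simp only [PropFormMod.ofPropForm, PropFormMod.subst, hσz 1 0 κ (Nat.zero_le _)]
  congr 2
  funext j
  exact j.elim0

/-- Axiom 3: the skeleton `Z(c,k+1,κ) ≡ (Z(c,k,κ) ∧ ¬y_k) ∨ (Z(c-1,k,κ) ∧ y_k)` becomes the
`MOD₂` axiom `MOD_{2,c}(y₀,…,y_k) ≡ [(MOD_{2,c}(y₀,…,y_{k-1}) ∧ ¬y_k) ∨ (MOD_{2,c-1}(…) ∧ y_k)]`.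
[Buss et al. 1997, Def. 1.1] [folklore] -/
theorem isModAxiom_subst_ax3 (hσv : ∀ v, v < n → σ v = .var v)
    (hσz : ∀ (c : ZMod 2) (k κ : ℕ), k ≤ n → σ (zv c k κ) =
      .modc c (fun j : Fin k => if (j : ℕ) ∈ Dof κ then .var (j : ℕ) else .const false))
    (c : ZMod 2) {k : ℕ} (hk : k < n) (κ : ℕ) :
    PropFormMod.IsModAxiom ((PropFormMod.ofPropForm
      (PropForm.biimp (PropForm.var (zv c (k + 1) κ))
        (PropForm.disj
          (PropForm.conj (PropForm.var (zv c k κ))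
            (PropForm.neg (if k ∈ Dof κ then PropForm.var k else PropForm.const false)))
          (PropForm.conj (PropForm.var (zv (c - 1) k κ))
            (if k ∈ Dof κ then PropForm.var k else PropForm.const false))))).subst σ) := by
  -- the substituted argument `y_k`
  have hy : (PropFormMod.ofPropForm
      (if k ∈ Dof κ then PropForm.var k else PropForm.const false)).subst σ =
        (if k ∈ Dof κ then PropFormMod.var (a := 2) k else PropFormMod.const false) := by
    split_ifs with h
    · simp [PropFormMod.ofPropForm, PropFormMod.subst, hσv k hk]
    · rfl
  refine Or.inr (Or.inr ⟨c, k,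
    fun j : Fin k => if (j : ℕ) ∈ Dof κ then .var (j : ℕ) else .const false,
    if k ∈ Dof κ then .var k else .const false, ?_⟩)
  have hsnoc : (fun j : Fin (k + 1) => if (j : ℕ) ∈ Dof κ then PropFormMod.var (a := 2) (j : ℕ)
      else PropFormMod.const false) =
      Fin.snoc (α := fun _ => PropFormMod 2 ℕ)
        (fun j : Fin k => if (j : ℕ) ∈ Dof κ then .var (j : ℕ) else .const false)
        (if k ∈ Dof κ then .var k else .const false) := by
    funext j
    refine Fin.lastCases ?_ (fun i => ?_) j
    · simp [Fin.snoc_last]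
    · simp [Fin.snoc_castSucc]
  simp only [PropForm.biimp, PropFormMod.ofPropForm, PropFormMod.subst, PropFormMod.biimp,
    hσz c (k + 1) κ hk, hσz c k κ hk.le, hσz (c - 1) k κ hk.le, hy, hsnoc]

end Axioms

end Summit.PneNP.PneNP.Theorems.ModTwo
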